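import Summits.Ventures.YMGap.RobustBall.HaarSecondMoments
import HarnessLib

/-!
# The Haar THIRD moments of `SU(3)`, I: the cubic entry moments and the baryon vertex `∫ U₀₀ U₁₁ U₂₂ dU = 1/6`
# (row type C-PRESS, endpoint `β = 0`, part 14a; part 14b `HaarThirdMomentSU3Trace`: `∫ (tr U)³ = 1`, `∫ (Re tr U)³ = 1/4`)

Cell `pub-ymgap`, seat ds-1 (gen 11). HONEST FRAMING: pure compact-group integration for a compact group `G ≅ SU(3)`
(`IsSpecialUnitaryModel ρ`); nothing lattice-specific, nothing about the continuum or the Clay problem. Kernel theorems only,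
0 compute, no definitions. Method = the invariance method of rb-p2's `HaarSecondMoments` one degree up:
* **phases** (`row_phase`, `col_phase`): the left/right twist by `diag(i, −i, 1)` or `diag(1, i, −i)` multiplies the cubic moment
  `T[i,j,k; l,m,n] = ∫ U_{il} U_{jm} U_{kn}` by a fourth root of unity, which is `≠ 1` unless the row (column) indices are a
  permutation of `(0,1,2)` — so all other cubic moments VANISH (`row_vanish`, `col_vanish`), and ALL moments `∫ U U Ū` vanish
  (`integral_entry_entry_conj_entry`);
* **signed transpositions** (`swapRow_apply`, `swapCol_apply`): permuting rows or columns multiplies `T` by the signature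
  (`rows_102`, …, `cols_201`);
* **`det U = 1`** integrated (`Matrix.det_fin_three`): `6 · T[0,1,2; 0,1,2] = 1`, ★ `integral_baryon : ∫ U₀₀ U₁₁ U₂₂ dU = 1/6`
  (Creutz (8.25): `∫ dU U_{i₁j₁}U_{i₂j₂}U_{i₃j₃} = ε_{i₁i₂i₃} ε_{j₁j₂j₃}/3!` for `SU(3)`).
`integral_diag3`: `∫ U_{ii}U_{jj}U_{kk} dU = 1/6` on permutations of `(0,1,2)`, `0` otherwise.
Consequences in part 14b (`HaarThirdMomentSU3Trace`): `∫ (tr U)³ dU = 1`, `∫ (tr U)² conj(tr U) dU = 0`, `∫ (Re tr U)³ dU = 1/4`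
— the third cumulant of the `SU(3)` plaquette variable `W = (1/3) Re tr U_p` under Haar measure is `1/108 ≠ 0` (for `SU(2)` it
vanishes, part 10). References: M. Creutz, *Quarks, gluons and lattices* (1983) §8 eqs. (8.19)–(8.25); Balian–Drouffe–Itzykson, Phys. Rev. D 11
(1975) 2104 §III. Everything here is proved. [folklore]
-/

noncomputable section

open MeasureTheory Complex
open Literature.MathematicalPhysics.QuantumLattice Literature.MathematicalPhysics.QuantumFieldTheory

namespace Summit.Ventures.YMGap.HaarThirdMomentSU3

section Model

variable {G : Type*} [Group G] [TopologicalSpace G] [IsTopologicalGroup G] [CompactSpace G]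
  [MeasurableSpace G] [BorelSpace G] (ρ : G →* Matrix (Fin 3) (Fin 3) ℂ)

/-- Local shorthand: the cubic Haar moment `T[i,j,k; l,m,n] = ∫ ρ(g)_{il} ρ(g)_{jm} ρ(g)_{kn} dg`. -/
local notation3 (prettyPrint := false) "T[" i "," j "," k ";" l "," m "," n "]" =>
  ∫ g, ρ g i l * ρ g j m * ρ g k n ∂haarProbability G

omit [IsTopologicalGroup G] [CompactSpace G] [MeasurableSpace G] [BorelSpace G] in
/-- Every value of the model `ρ : G ≅ SU(3)` is a special unitary matrix. [folklore] -/
theorem mem_SU (hρ : IsSpecialUnitaryModel ρ) (g : G) : ρ g ∈ Matrix.specialUnitaryGroup (Fin 3) ℂ := by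
  have h : ρ g ∈ (Matrix.specialUnitaryGroup (Fin 3) ℂ : Set (Matrix (Fin 3) (Fin 3) ℂ)) :=
    hρ.2.2 ▸ Set.mem_range_self g
  exact h

/-- Triple products of entries of `ρ(g)` are Haar integrable. [folklore] -/
theorem integrable_entry3 (hρ : Continuous ρ) (i j k l m n : Fin 3) :
    Integrable (fun g => ρ g i l * ρ g j m * ρ g k n) (haarProbability G) :=
  (((hρ.matrix_elem i l).mul (hρ.matrix_elem j m)).mul (hρ.matrix_elem k n)).integrable_of_hasCompactSupport
    (HasCompactSupport.of_compactSpace _)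

omit [IsTopologicalGroup G] [CompactSpace G] [BorelSpace G] in
/-- A complex number fixed by multiplication with `c ≠ 1` is zero. [folklore] -/
theorem eq_zero_of_mul_eq_self {c z : ℂ} (hc : c ≠ 1) (h : c * z = z) : z = 0 := by
  have h' : (c - 1) * z = 0 := by rw [sub_mul, one_mul, h, sub_self]
  rcases mul_eq_zero.mp h' with h'' | h''
  · exact absurd (sub_eq_zero.mp h'') hc
  · exact h''

omit [IsTopologicalGroup G] [CompactSpace G] [BorelSpace G] in
/-- Off-diagonal values of `Pi.mulSingle` on `Fin 3` (for the phase computations). [folklore] -/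
theorem mulSingle_offdiag (x : ℂ) :
    (Pi.mulSingle (0 : Fin 3) x : Fin 3 → ℂ) 1 = 1 ∧ (Pi.mulSingle (0 : Fin 3) x : Fin 3 → ℂ) 2 = 1 ∧
      (Pi.mulSingle (1 : Fin 3) x : Fin 3 → ℂ) 0 = 1 ∧ (Pi.mulSingle (1 : Fin 3) x : Fin 3 → ℂ) 2 = 1 ∧
      (Pi.mulSingle (2 : Fin 3) x : Fin 3 → ℂ) 0 = 1 ∧ (Pi.mulSingle (2 : Fin 3) x : Fin 3 → ℂ) 1 = 1 :=
  ⟨Pi.mulSingle_eq_of_ne (show (1 : Fin 3) ≠ 0 by decide) x, Pi.mulSingle_eq_of_ne (show (2 : Fin 3) ≠ 0 by decide) x,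
    Pi.mulSingle_eq_of_ne (show (0 : Fin 3) ≠ 1 by decide) x, Pi.mulSingle_eq_of_ne (show (2 : Fin 3) ≠ 1 by decide) x,
    Pi.mulSingle_eq_of_ne (show (0 : Fin 3) ≠ 2 by decide) x, Pi.mulSingle_eq_of_ne (show (1 : Fin 3) ≠ 2 by decide) x⟩

/-! ### Phases: only permutation patterns survive -/

/-- **Row phase**: the left twist by `diag(e_a ↦ i, e_b ↦ −i)` multiplies `T[i,j,k; l,m,n]` by `d_i d_j d_k`. [folklore] -/
theorem row_phase (hρ : IsSpecialUnitaryModel ρ) {a b : Fin 3} (hab : a ≠ b) (i j k l m n : Fin 3) :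
    ((Pi.mulSingle a I * Pi.mulSingle b (-I) : Fin 3 → ℂ) i * (Pi.mulSingle a I * Pi.mulSingle b (-I) : Fin 3 → ℂ) j *
        (Pi.mulSingle a I * Pi.mulSingle b (-I) : Fin 3 → ℂ) k) * T[i,j,k;l,m,n] = T[i,j,k;l,m,n] := by
  set d : Fin 3 → ℂ := Pi.mulSingle a I * Pi.mulSingle b (-I) with hd
  have hDm : Matrix.diagonal d ∈ Matrix.specialUnitaryGroup (Fin 3) ℂ :=
    RobustBall.HaarSecondMoments.diagonal_phase_mem a b hab
  have h := RobustBall.HaarSecondMoments.integral_comp_mul_left ρ hρ hDm (fun M => M i l * M j m * M k n)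
  simp only [Matrix.diagonal_mul] at h
  calc (d i * d j * d k) * T[i,j,k;l,m,n]
      = ∫ g, (d i * d j * d k) * (ρ g i l * ρ g j m * ρ g k n) ∂haarProbability G := (integral_const_mul _ _).symm
    _ = ∫ g, d i * ρ g i l * (d j * ρ g j m) * (d k * ρ g k n) ∂haarProbability G :=
        integral_congr_ae (Filter.Eventually.of_forall fun g => by ring)
    _ = T[i,j,k;l,m,n] := h

/-- **Column phase**: the right twist by `diag(e_a ↦ i, e_b ↦ −i)` multiplies `T[i,j,k; l,m,n]` by `d_l d_m d_n`. [folklore] -/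
theorem col_phase (hρ : IsSpecialUnitaryModel ρ) {a b : Fin 3} (hab : a ≠ b) (i j k l m n : Fin 3) :
    ((Pi.mulSingle a I * Pi.mulSingle b (-I) : Fin 3 → ℂ) l * (Pi.mulSingle a I * Pi.mulSingle b (-I) : Fin 3 → ℂ) m *
        (Pi.mulSingle a I * Pi.mulSingle b (-I) : Fin 3 → ℂ) n) * T[i,j,k;l,m,n] = T[i,j,k;l,m,n] := by
  set d : Fin 3 → ℂ := Pi.mulSingle a I * Pi.mulSingle b (-I) with hd
  have hDm : Matrix.diagonal d ∈ Matrix.specialUnitaryGroup (Fin 3) ℂ :=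
    RobustBall.HaarSecondMoments.diagonal_phase_mem a b hab
  have h := RobustBall.HaarSecondMoments.integral_comp_mul_right ρ hρ hDm (fun M => M i l * M j m * M k n)
  simp only [Matrix.mul_diagonal] at h
  calc (d l * d m * d n) * T[i,j,k;l,m,n]
      = ∫ g, (d l * d m * d n) * (ρ g i l * ρ g j m * ρ g k n) ∂haarProbability G := (integral_const_mul _ _).symm
    _ = ∫ g, ρ g i l * d l * (ρ g j m * d m) * (ρ g k n * d n) ∂haarProbability G :=
        integral_congr_ae (Filter.Eventually.of_forall fun g => by ring)
    _ = T[i,j,k;l,m,n] := h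

/-- ★ **Cubic moments whose ROW indices are not pairwise distinct vanish** (`G ≅ SU(3)`): the two phase twists
`diag(i, −i, 1)`, `diag(1, i, −i)` kill every non-permutation row pattern. [folklore] -/
theorem row_vanish (hρ : IsSpecialUnitaryModel ρ) {i j k : Fin 3} (h : i = j ∨ j = k ∨ i = k) (l m n : Fin 3) :
    T[i,j,k;l,m,n] = 0 := by
  rcases (show i = 0 ∨ i = 1 ∨ i = 2 by fin_cases i <;> simp) with rfl | rfl | rfl <;>
    rcases (show j = 0 ∨ j = 1 ∨ j = 2 by fin_cases j <;> simp) with rfl | rfl | rfl <;>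
    rcases (show k = 0 ∨ k = 1 ∨ k = 2 by fin_cases k <;> simp) with rfl | rfl | rfl <;> simp at h <;>
    first
    | (refine eq_zero_of_mul_eq_self ?_ (row_phase ρ hρ (a := 0) (b := 1) (by decide) _ _ _ l m n);
        norm_num [mulSingle_offdiag, Complex.ext_iff]; done)
    | (refine eq_zero_of_mul_eq_self ?_ (row_phase ρ hρ (a := 1) (b := 2) (by decide) _ _ _ l m n);
        norm_num [mulSingle_offdiag, Complex.ext_iff])

/-- ★ **Cubic moments whose COLUMN indices are not pairwise distinct vanish** (`G ≅ SU(3)`). [folklore] -/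
theorem col_vanish (hρ : IsSpecialUnitaryModel ρ) (i j k : Fin 3) {l m n : Fin 3} (h : l = m ∨ m = n ∨ l = n) :
    T[i,j,k;l,m,n] = 0 := by
  rcases (show l = 0 ∨ l = 1 ∨ l = 2 by fin_cases l <;> simp) with rfl | rfl | rfl <;>
    rcases (show m = 0 ∨ m = 1 ∨ m = 2 by fin_cases m <;> simp) with rfl | rfl | rfl <;>
    rcases (show n = 0 ∨ n = 1 ∨ n = 2 by fin_cases n <;> simp) with rfl | rfl | rfl <;> simp at h <;>
    first
    | (refine eq_zero_of_mul_eq_self ?_ (col_phase ρ hρ (a := 0) (b := 1) (by decide) i j k _ _ _);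
        norm_num [mulSingle_offdiag, Complex.ext_iff]; done)
    | (refine eq_zero_of_mul_eq_self ?_ (col_phase ρ hρ (a := 1) (b := 2) (by decide) i j k _ _ _);
        norm_num [mulSingle_offdiag, Complex.ext_iff])

/-- **Row phase for `∫ U U Ū`**: the left twist multiplies `∫ ρ_{il} ρ_{jm} conj(ρ_{kn})` by `d_i d_j conj(d_k)`. [folklore] -/
theorem row_phase_conj (hρ : IsSpecialUnitaryModel ρ) {a b : Fin 3} (hab : a ≠ b) (i j k l m n : Fin 3) :
    ((Pi.mulSingle a I * Pi.mulSingle b (-I) : Fin 3 → ℂ) i * (Pi.mulSingle a I * Pi.mulSingle b (-I) : Fin 3 → ℂ) j *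
        (starRingEnd ℂ) ((Pi.mulSingle a I * Pi.mulSingle b (-I) : Fin 3 → ℂ) k)) *
      (∫ g, ρ g i l * ρ g j m * (starRingEnd ℂ) (ρ g k n) ∂haarProbability G) =
      ∫ g, ρ g i l * ρ g j m * (starRingEnd ℂ) (ρ g k n) ∂haarProbability G := by
  set d : Fin 3 → ℂ := Pi.mulSingle a I * Pi.mulSingle b (-I) with hd
  have hDm : Matrix.diagonal d ∈ Matrix.specialUnitaryGroup (Fin 3) ℂ :=
    RobustBall.HaarSecondMoments.diagonal_phase_mem a b hab
  have h := RobustBall.HaarSecondMoments.integral_comp_mul_left ρ hρ hDm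
    (fun M => M i l * M j m * (starRingEnd ℂ) (M k n))
  simp only [Matrix.diagonal_mul, map_mul] at h
  calc (d i * d j * (starRingEnd ℂ) (d k)) * ∫ g, ρ g i l * ρ g j m * (starRingEnd ℂ) (ρ g k n) ∂haarProbability G
      = ∫ g, (d i * d j * (starRingEnd ℂ) (d k)) * (ρ g i l * ρ g j m * (starRingEnd ℂ) (ρ g k n)) ∂haarProbability G :=
        (integral_const_mul _ _).symm
    _ = ∫ g, d i * ρ g i l * (d j * ρ g j m) * ((starRingEnd ℂ) (d k) * (starRingEnd ℂ) (ρ g k n)) ∂haarProbability G :=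
        integral_congr_ae (Filter.Eventually.of_forall fun g => by ring)
    _ = ∫ g, ρ g i l * ρ g j m * (starRingEnd ℂ) (ρ g k n) ∂haarProbability G := h

/-- ★ **Every moment `∫ U_{il} U_{jm} conj(U_{kn}) dU` of `SU(3)` vanishes** (no invariant in `V ⊗ V ⊗ V̄`): each of the
`27` row patterns is killed by one of the two phase twists. [folklore] -/
theorem integral_entry_entry_conj_entry (hρ : IsSpecialUnitaryModel ρ) (i j k l m n : Fin 3) :
    ∫ g, ρ g i l * ρ g j m * (starRingEnd ℂ) (ρ g k n) ∂haarProbability G = 0 := by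
  rcases (show i = 0 ∨ i = 1 ∨ i = 2 by fin_cases i <;> simp) with rfl | rfl | rfl <;>
    rcases (show j = 0 ∨ j = 1 ∨ j = 2 by fin_cases j <;> simp) with rfl | rfl | rfl <;>
    rcases (show k = 0 ∨ k = 1 ∨ k = 2 by fin_cases k <;> simp) with rfl | rfl | rfl <;>
    first
    | (refine eq_zero_of_mul_eq_self ?_ (row_phase_conj ρ hρ (a := 0) (b := 1) (by decide) _ _ _ l m n);
        norm_num [mulSingle_offdiag, Complex.ext_iff]; done)
    | (refine eq_zero_of_mul_eq_self ?_ (row_phase_conj ρ hρ (a := 1) (b := 2) (by decide) _ _ _ l m n);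
        norm_num [mulSingle_offdiag, Complex.ext_iff])

/-! ### Signed transpositions: permutation patterns carry the signature -/

omit [IsTopologicalGroup G] [CompactSpace G] [MeasurableSpace G] [BorelSpace G] in
/-- Left multiplication by the signed transposition `swap(a,b)·diag(−1 at a)`: row `a ↦ row b`, row `b ↦ −row a`, other
rows fixed. [folklore] -/
theorem swapRow_apply {a b : Fin 3} (hab : a ≠ b) (M : Matrix (Fin 3) (Fin 3) ℂ) :
    (∀ c, (Matrix.swap ℂ a b * Matrix.diagonal (Pi.mulSingle a (-1 : ℂ)) * M) a c = M b c) ∧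
      (∀ c, (Matrix.swap ℂ a b * Matrix.diagonal (Pi.mulSingle a (-1 : ℂ)) * M) b c = -M a c) ∧
      ∀ r, r ≠ a → r ≠ b → ∀ c, (Matrix.swap ℂ a b * Matrix.diagonal (Pi.mulSingle a (-1 : ℂ)) * M) r c = M r c := by
  have hD : ∀ r c, (Matrix.diagonal (Pi.mulSingle a (-1 : ℂ)) * M) r c = (Pi.mulSingle a (-1 : ℂ) : Fin 3 → ℂ) r * M r c :=
    fun r c => Matrix.diagonal_mul _ _ _ _
  refine ⟨fun c => ?_, fun c => ?_, fun r hra hrb c => ?_⟩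
  · rw [Matrix.mul_assoc, Matrix.swap_mul_apply_left, hD, Pi.mulSingle_eq_of_ne hab.symm, one_mul]
  · rw [Matrix.mul_assoc, Matrix.swap_mul_apply_right, hD, Pi.mulSingle_eq_same, neg_one_mul]
  · rw [Matrix.mul_assoc, Matrix.swap_mul_of_ne hra hrb, hD, Pi.mulSingle_eq_of_ne hra, one_mul]

omit [IsTopologicalGroup G] [CompactSpace G] [MeasurableSpace G] [BorelSpace G] in
/-- Right multiplication by the signed transposition: column `a ↦ −column b`, column `b ↦ column a`, others fixed. [folklore] -/
theorem swapCol_apply {a b : Fin 3} (hab : a ≠ b) (M : Matrix (Fin 3) (Fin 3) ℂ) :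
    (∀ r, (M * (Matrix.swap ℂ a b * Matrix.diagonal (Pi.mulSingle a (-1 : ℂ)))) r a = -M r b) ∧
      (∀ r, (M * (Matrix.swap ℂ a b * Matrix.diagonal (Pi.mulSingle a (-1 : ℂ)))) r b = M r a) ∧
      ∀ c, c ≠ a → c ≠ b → ∀ r, (M * (Matrix.swap ℂ a b * Matrix.diagonal (Pi.mulSingle a (-1 : ℂ)))) r c = M r c := by
  have hD : ∀ r c, (M * Matrix.swap ℂ a b * Matrix.diagonal (Pi.mulSingle a (-1 : ℂ))) r c =
      (M * Matrix.swap ℂ a b) r c * (Pi.mulSingle a (-1 : ℂ) : Fin 3 → ℂ) c := fun r c => Matrix.mul_diagonal _ _ _ _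
  refine ⟨fun r => ?_, fun r => ?_, fun c hca hcb r => ?_⟩
  · rw [← Matrix.mul_assoc, hD, Matrix.mul_swap_apply_left, Pi.mulSingle_eq_same, mul_neg_one]
  · rw [← Matrix.mul_assoc, hD, Matrix.mul_swap_apply_right, Pi.mulSingle_eq_of_ne hab.symm, mul_one]
  · rw [← Matrix.mul_assoc, hD, Matrix.mul_swap_of_ne hca hcb, Pi.mulSingle_eq_of_ne hca, mul_one]

/-- `T[1,0,2; ·] = −T[0,1,2; ·]` (rows `0 ↔ 1`). [folklore] -/
theorem rows_102 (hρ : IsSpecialUnitaryModel ρ) (l m n : Fin 3) : T[1,0,2;l,m,n] = -T[0,1,2;l,m,n] := by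
  have hS := RobustBall.HaarSecondMoments.swap_mul_sign_mem (N := 3) (0 : Fin 3) 1 (by decide)
  have h := RobustBall.HaarSecondMoments.integral_comp_mul_left ρ hρ hS (fun M => M 0 l * M 1 m * M 2 n)
  have hpt : ∀ g : G, (Matrix.swap ℂ (0 : Fin 3) 1 * Matrix.diagonal (Pi.mulSingle (0 : Fin 3) (-1 : ℂ)) * ρ g) 0 l *
      (Matrix.swap ℂ (0 : Fin 3) 1 * Matrix.diagonal (Pi.mulSingle (0 : Fin 3) (-1 : ℂ)) * ρ g) 1 m *
      (Matrix.swap ℂ (0 : Fin 3) 1 * Matrix.diagonal (Pi.mulSingle (0 : Fin 3) (-1 : ℂ)) * ρ g) 2 n =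
      -(ρ g 1 l * ρ g 0 m * ρ g 2 n) := fun g => by
    obtain ⟨h0, h1, h2⟩ := swapRow_apply (a := (0 : Fin 3)) (b := 1) (by decide) (ρ g)
    rw [h0 l, h1 m, h2 2 (by decide) (by decide) n]; ring
  simp only [hpt, integral_neg] at h
  linear_combination -h

/-- `T[0,2,1; ·] = −T[0,1,2; ·]` (rows `1 ↔ 2`). [folklore] -/
theorem rows_021 (hρ : IsSpecialUnitaryModel ρ) (l m n : Fin 3) : T[0,2,1;l,m,n] = -T[0,1,2;l,m,n] := by
  have hS := RobustBall.HaarSecondMoments.swap_mul_sign_mem (N := 3) (1 : Fin 3) 2 (by decide)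
  have h := RobustBall.HaarSecondMoments.integral_comp_mul_left ρ hρ hS (fun M => M 0 l * M 1 m * M 2 n)
  have hpt : ∀ g : G, (Matrix.swap ℂ (1 : Fin 3) 2 * Matrix.diagonal (Pi.mulSingle (1 : Fin 3) (-1 : ℂ)) * ρ g) 0 l *
      (Matrix.swap ℂ (1 : Fin 3) 2 * Matrix.diagonal (Pi.mulSingle (1 : Fin 3) (-1 : ℂ)) * ρ g) 1 m *
      (Matrix.swap ℂ (1 : Fin 3) 2 * Matrix.diagonal (Pi.mulSingle (1 : Fin 3) (-1 : ℂ)) * ρ g) 2 n =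
      -(ρ g 0 l * ρ g 2 m * ρ g 1 n) := fun g => by
    obtain ⟨h1, h2, h0⟩ := swapRow_apply (a := (1 : Fin 3)) (b := 2) (by decide) (ρ g)
    rw [h0 0 (by decide) (by decide) l, h1 m, h2 n]; ring
  simp only [hpt, integral_neg] at h
  linear_combination -h

/-- `T[2,1,0; ·] = −T[0,1,2; ·]` (rows `0 ↔ 2`). [folklore] -/
theorem rows_210 (hρ : IsSpecialUnitaryModel ρ) (l m n : Fin 3) : T[2,1,0;l,m,n] = -T[0,1,2;l,m,n] := by
  have hS := RobustBall.HaarSecondMoments.swap_mul_sign_mem (N := 3) (0 : Fin 3) 2 (by decide)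
  have h := RobustBall.HaarSecondMoments.integral_comp_mul_left ρ hρ hS (fun M => M 0 l * M 1 m * M 2 n)
  have hpt : ∀ g : G, (Matrix.swap ℂ (0 : Fin 3) 2 * Matrix.diagonal (Pi.mulSingle (0 : Fin 3) (-1 : ℂ)) * ρ g) 0 l *
      (Matrix.swap ℂ (0 : Fin 3) 2 * Matrix.diagonal (Pi.mulSingle (0 : Fin 3) (-1 : ℂ)) * ρ g) 1 m *
      (Matrix.swap ℂ (0 : Fin 3) 2 * Matrix.diagonal (Pi.mulSingle (0 : Fin 3) (-1 : ℂ)) * ρ g) 2 n =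
      -(ρ g 2 l * ρ g 1 m * ρ g 0 n) := fun g => by
    obtain ⟨h0, h2, h1⟩ := swapRow_apply (a := (0 : Fin 3)) (b := 2) (by decide) (ρ g)
    rw [h0 l, h1 1 (by decide) (by decide) m, h2 n]; ring
  simp only [hpt, integral_neg] at h
  linear_combination -h

/-- `T[1,2,0; ·] = T[0,1,2; ·]` (a 3-cycle on rows). [folklore] -/
theorem rows_120 (hρ : IsSpecialUnitaryModel ρ) (l m n : Fin 3) : T[1,2,0;l,m,n] = T[0,1,2;l,m,n] := by
  have hS := RobustBall.HaarSecondMoments.swap_mul_sign_mem (N := 3) (0 : Fin 3) 1 (by decide)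
  have h := RobustBall.HaarSecondMoments.integral_comp_mul_left ρ hρ hS (fun M => M 0 l * M 2 m * M 1 n)
  have hpt : ∀ g : G, (Matrix.swap ℂ (0 : Fin 3) 1 * Matrix.diagonal (Pi.mulSingle (0 : Fin 3) (-1 : ℂ)) * ρ g) 0 l *
      (Matrix.swap ℂ (0 : Fin 3) 1 * Matrix.diagonal (Pi.mulSingle (0 : Fin 3) (-1 : ℂ)) * ρ g) 2 m *
      (Matrix.swap ℂ (0 : Fin 3) 1 * Matrix.diagonal (Pi.mulSingle (0 : Fin 3) (-1 : ℂ)) * ρ g) 1 n =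
      -(ρ g 1 l * ρ g 2 m * ρ g 0 n) := fun g => by
    obtain ⟨h0, h1, h2⟩ := swapRow_apply (a := (0 : Fin 3)) (b := 1) (by decide) (ρ g)
    rw [h0 l, h2 2 (by decide) (by decide) m, h1 n]; ring
  simp only [hpt, integral_neg] at h
  have h' := rows_021 ρ hρ l m n
  linear_combination -h - h'

/-- `T[2,0,1; ·] = T[0,1,2; ·]` (the other 3-cycle on rows). [folklore] -/
theorem rows_201 (hρ : IsSpecialUnitaryModel ρ) (l m n : Fin 3) : T[2,0,1;l,m,n] = T[0,1,2;l,m,n] := by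
  have hS := RobustBall.HaarSecondMoments.swap_mul_sign_mem (N := 3) (0 : Fin 3) 1 (by decide)
  have h := RobustBall.HaarSecondMoments.integral_comp_mul_left ρ hρ hS (fun M => M 2 l * M 1 m * M 0 n)
  have hpt : ∀ g : G, (Matrix.swap ℂ (0 : Fin 3) 1 * Matrix.diagonal (Pi.mulSingle (0 : Fin 3) (-1 : ℂ)) * ρ g) 2 l *
      (Matrix.swap ℂ (0 : Fin 3) 1 * Matrix.diagonal (Pi.mulSingle (0 : Fin 3) (-1 : ℂ)) * ρ g) 1 m *
      (Matrix.swap ℂ (0 : Fin 3) 1 * Matrix.diagonal (Pi.mulSingle (0 : Fin 3) (-1 : ℂ)) * ρ g) 0 n =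
      -(ρ g 2 l * ρ g 0 m * ρ g 1 n) := fun g => by
    obtain ⟨h0, h1, h2⟩ := swapRow_apply (a := (0 : Fin 3)) (b := 1) (by decide) (ρ g)
    rw [h2 2 (by decide) (by decide) l, h1 m, h0 n]; ring
  simp only [hpt, integral_neg] at h
  have h' := rows_210 ρ hρ l m n
  linear_combination -h - h'

/-- `T[·; 1,0,2] = −T[·; 0,1,2]` (columns `0 ↔ 1`). [folklore] -/
theorem cols_102 (hρ : IsSpecialUnitaryModel ρ) (i j k : Fin 3) : T[i,j,k;1,0,2] = -T[i,j,k;0,1,2] := by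
  have hS := RobustBall.HaarSecondMoments.swap_mul_sign_mem (N := 3) (0 : Fin 3) 1 (by decide)
  have h := RobustBall.HaarSecondMoments.integral_comp_mul_right ρ hρ hS (fun M => M i 0 * M j 1 * M k 2)
  have hpt : ∀ g : G, (ρ g * (Matrix.swap ℂ (0 : Fin 3) 1 * Matrix.diagonal (Pi.mulSingle (0 : Fin 3) (-1 : ℂ)))) i 0 *
      (ρ g * (Matrix.swap ℂ (0 : Fin 3) 1 * Matrix.diagonal (Pi.mulSingle (0 : Fin 3) (-1 : ℂ)))) j 1 *
      (ρ g * (Matrix.swap ℂ (0 : Fin 3) 1 * Matrix.diagonal (Pi.mulSingle (0 : Fin 3) (-1 : ℂ)))) k 2 =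
      -(ρ g i 1 * ρ g j 0 * ρ g k 2) := fun g => by
    obtain ⟨h0, h1, h2⟩ := swapCol_apply (a := (0 : Fin 3)) (b := 1) (by decide) (ρ g)
    rw [h0 i, h1 j, h2 2 (by decide) (by decide) k]; ring
  simp only [hpt, integral_neg] at h
  linear_combination -h

/-- `T[·; 0,2,1] = −T[·; 0,1,2]` (columns `1 ↔ 2`). [folklore] -/
theorem cols_021 (hρ : IsSpecialUnitaryModel ρ) (i j k : Fin 3) : T[i,j,k;0,2,1] = -T[i,j,k;0,1,2] := by
  have hS := RobustBall.HaarSecondMoments.swap_mul_sign_mem (N := 3) (1 : Fin 3) 2 (by decide)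
  have h := RobustBall.HaarSecondMoments.integral_comp_mul_right ρ hρ hS (fun M => M i 0 * M j 1 * M k 2)
  have hpt : ∀ g : G, (ρ g * (Matrix.swap ℂ (1 : Fin 3) 2 * Matrix.diagonal (Pi.mulSingle (1 : Fin 3) (-1 : ℂ)))) i 0 *
      (ρ g * (Matrix.swap ℂ (1 : Fin 3) 2 * Matrix.diagonal (Pi.mulSingle (1 : Fin 3) (-1 : ℂ)))) j 1 *
      (ρ g * (Matrix.swap ℂ (1 : Fin 3) 2 * Matrix.diagonal (Pi.mulSingle (1 : Fin 3) (-1 : ℂ)))) k 2 =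
      -(ρ g i 0 * ρ g j 2 * ρ g k 1) := fun g => by
    obtain ⟨h1, h2, h0⟩ := swapCol_apply (a := (1 : Fin 3)) (b := 2) (by decide) (ρ g)
    rw [h0 0 (by decide) (by decide) i, h1 j, h2 k]; ring
  simp only [hpt, integral_neg] at h
  linear_combination -h

/-- `T[·; 2,1,0] = −T[·; 0,1,2]` (columns `0 ↔ 2`). [folklore] -/
theorem cols_210 (hρ : IsSpecialUnitaryModel ρ) (i j k : Fin 3) : T[i,j,k;2,1,0] = -T[i,j,k;0,1,2] := by
  have hS := RobustBall.HaarSecondMoments.swap_mul_sign_mem (N := 3) (0 : Fin 3) 2 (by decide)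
  have h := RobustBall.HaarSecondMoments.integral_comp_mul_right ρ hρ hS (fun M => M i 0 * M j 1 * M k 2)
  have hpt : ∀ g : G, (ρ g * (Matrix.swap ℂ (0 : Fin 3) 2 * Matrix.diagonal (Pi.mulSingle (0 : Fin 3) (-1 : ℂ)))) i 0 *
      (ρ g * (Matrix.swap ℂ (0 : Fin 3) 2 * Matrix.diagonal (Pi.mulSingle (0 : Fin 3) (-1 : ℂ)))) j 1 *
      (ρ g * (Matrix.swap ℂ (0 : Fin 3) 2 * Matrix.diagonal (Pi.mulSingle (0 : Fin 3) (-1 : ℂ)))) k 2 =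
      -(ρ g i 2 * ρ g j 1 * ρ g k 0) := fun g => by
    obtain ⟨h0, h2, h1⟩ := swapCol_apply (a := (0 : Fin 3)) (b := 2) (by decide) (ρ g)
    rw [h0 i, h1 1 (by decide) (by decide) j, h2 k]; ring
  simp only [hpt, integral_neg] at h
  linear_combination -h

/-- `T[·; 1,2,0] = T[·; 0,1,2]` (a 3-cycle on columns). [folklore] -/
theorem cols_120 (hρ : IsSpecialUnitaryModel ρ) (i j k : Fin 3) : T[i,j,k;1,2,0] = T[i,j,k;0,1,2] := by
  have hS := RobustBall.HaarSecondMoments.swap_mul_sign_mem (N := 3) (0 : Fin 3) 1 (by decide)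
  have h := RobustBall.HaarSecondMoments.integral_comp_mul_right ρ hρ hS (fun M => M i 0 * M j 2 * M k 1)
  have hpt : ∀ g : G, (ρ g * (Matrix.swap ℂ (0 : Fin 3) 1 * Matrix.diagonal (Pi.mulSingle (0 : Fin 3) (-1 : ℂ)))) i 0 *
      (ρ g * (Matrix.swap ℂ (0 : Fin 3) 1 * Matrix.diagonal (Pi.mulSingle (0 : Fin 3) (-1 : ℂ)))) j 2 *
      (ρ g * (Matrix.swap ℂ (0 : Fin 3) 1 * Matrix.diagonal (Pi.mulSingle (0 : Fin 3) (-1 : ℂ)))) k 1 =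
      -(ρ g i 1 * ρ g j 2 * ρ g k 0) := fun g => by
    obtain ⟨h0, h1, h2⟩ := swapCol_apply (a := (0 : Fin 3)) (b := 1) (by decide) (ρ g)
    rw [h0 i, h2 2 (by decide) (by decide) j, h1 k]; ring
  simp only [hpt, integral_neg] at h
  have h' := cols_021 ρ hρ i j k
  linear_combination -h - h'

/-- `T[·; 2,0,1] = T[·; 0,1,2]` (the other 3-cycle on columns). [folklore] -/
theorem cols_201 (hρ : IsSpecialUnitaryModel ρ) (i j k : Fin 3) : T[i,j,k;2,0,1] = T[i,j,k;0,1,2] := by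
  have hS := RobustBall.HaarSecondMoments.swap_mul_sign_mem (N := 3) (0 : Fin 3) 1 (by decide)
  have h := RobustBall.HaarSecondMoments.integral_comp_mul_right ρ hρ hS (fun M => M i 2 * M j 1 * M k 0)
  have hpt : ∀ g : G, (ρ g * (Matrix.swap ℂ (0 : Fin 3) 1 * Matrix.diagonal (Pi.mulSingle (0 : Fin 3) (-1 : ℂ)))) i 2 *
      (ρ g * (Matrix.swap ℂ (0 : Fin 3) 1 * Matrix.diagonal (Pi.mulSingle (0 : Fin 3) (-1 : ℂ)))) j 1 *
      (ρ g * (Matrix.swap ℂ (0 : Fin 3) 1 * Matrix.diagonal (Pi.mulSingle (0 : Fin 3) (-1 : ℂ)))) k 0 =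
      -(ρ g i 2 * ρ g j 0 * ρ g k 1) := fun g => by
    obtain ⟨h0, h1, h2⟩ := swapCol_apply (a := (0 : Fin 3)) (b := 1) (by decide) (ρ g)
    rw [h2 2 (by decide) (by decide) i, h1 j, h0 k]; ring
  simp only [hpt, integral_neg] at h
  have h' := cols_210 ρ hρ i j k
  linear_combination -h - h'

/-! ### `det = 1`: the baryon normalisation -/

/-- ★★ **THE `SU(3)` BARYON VERTEX: `∫ ρ(g)₀₀ ρ(g)₁₁ ρ(g)₂₂ dg = 1/6`** — integrate `det ρ(g) = 1` (six signed cubic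
moments, each `± T[0,1,2; 0,1,2]` by the column transpositions). Creutz (8.25) for `SU(3)`. [folklore] -/
theorem integral_baryon (hρ : IsSpecialUnitaryModel ρ) : T[0,1,2;0,1,2] = 1 / 6 := by
  have hdet : ∀ g : G, (ρ g).det = 1 := fun g => (Matrix.mem_specialUnitaryGroup_iff.mp (mem_SU ρ hρ g)).2
  have hI : ∀ i j k l m n : Fin 3, Integrable (fun g => ρ g i l * ρ g j m * ρ g k n) (haarProbability G) :=
    fun i j k l m n => integrable_entry3 ρ hρ.1 i j k l m n
  have h1 : ∫ g, (ρ g).det ∂haarProbability G = 1 := by simp [hdet]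
  simp_rw [Matrix.det_fin_three] at h1
  have hsplit : ∫ g, (ρ g 0 0 * ρ g 1 1 * ρ g 2 2 - ρ g 0 0 * ρ g 1 2 * ρ g 2 1 - ρ g 0 1 * ρ g 1 0 * ρ g 2 2 +
      ρ g 0 1 * ρ g 1 2 * ρ g 2 0 + ρ g 0 2 * ρ g 1 0 * ρ g 2 1 - ρ g 0 2 * ρ g 1 1 * ρ g 2 0) ∂haarProbability G =
      T[0,1,2;0,1,2] - T[0,1,2;0,2,1] - T[0,1,2;1,0,2] + T[0,1,2;1,2,0] + T[0,1,2;2,0,1] - T[0,1,2;2,1,0] := by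
    have i1 := hI 0 1 2 0 1 2
    have i2 := hI 0 1 2 0 2 1
    have i3 := hI 0 1 2 1 0 2
    have i4 := hI 0 1 2 1 2 0
    have i5 := hI 0 1 2 2 0 1
    have i6 := hI 0 1 2 2 1 0
    have i12 : Integrable (fun g => ρ g 0 0 * ρ g 1 1 * ρ g 2 2 - ρ g 0 0 * ρ g 1 2 * ρ g 2 1) (haarProbability G) :=
      i1.sub i2
    have i123 : Integrable (fun g => ρ g 0 0 * ρ g 1 1 * ρ g 2 2 - ρ g 0 0 * ρ g 1 2 * ρ g 2 1 -
        ρ g 0 1 * ρ g 1 0 * ρ g 2 2) (haarProbability G) := i12.sub i3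
    have i1234 : Integrable (fun g => ρ g 0 0 * ρ g 1 1 * ρ g 2 2 - ρ g 0 0 * ρ g 1 2 * ρ g 2 1 -
        ρ g 0 1 * ρ g 1 0 * ρ g 2 2 + ρ g 0 1 * ρ g 1 2 * ρ g 2 0) (haarProbability G) := i123.add i4
    have i12345 : Integrable (fun g => ρ g 0 0 * ρ g 1 1 * ρ g 2 2 - ρ g 0 0 * ρ g 1 2 * ρ g 2 1 -
        ρ g 0 1 * ρ g 1 0 * ρ g 2 2 + ρ g 0 1 * ρ g 1 2 * ρ g 2 0 + ρ g 0 2 * ρ g 1 0 * ρ g 2 1) (haarProbability G) :=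
      i1234.add i5
    rw [integral_sub i12345 i6, integral_add i1234 i5, integral_add i123 i4, integral_sub i12 i3, integral_sub i1 i2]
  rw [hsplit, cols_021 ρ hρ, cols_102 ρ hρ, cols_120 ρ hρ, cols_201 ρ hρ, cols_210 ρ hρ] at h1
  linear_combination h1 / 6

/-- **The diagonal cubic moments**: `∫ ρ_{ii} ρ_{jj} ρ_{kk} dg = 1/6` if `(i,j,k)` is a permutation of `(0,1,2)` and `0`
otherwise. [folklore] -/
theorem integral_diag3 (hρ : IsSpecialUnitaryModel ρ) (i j k : Fin 3) :
    T[i,j,k;i,j,k] = if i ≠ j ∧ j ≠ k ∧ i ≠ k then (1 / 6 : ℂ) else 0 := by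
  have t := integral_baryon ρ hρ
  have p102 : T[1,0,2;1,0,2] = 1 / 6 := by rw [rows_102 ρ hρ, cols_102 ρ hρ, neg_neg, t]
  have p021 : T[0,2,1;0,2,1] = 1 / 6 := by rw [rows_021 ρ hρ, cols_021 ρ hρ, neg_neg, t]
  have p210 : T[2,1,0;2,1,0] = 1 / 6 := by rw [rows_210 ρ hρ, cols_210 ρ hρ, neg_neg, t]
  have p120 : T[1,2,0;1,2,0] = 1 / 6 := by rw [rows_120 ρ hρ, cols_120 ρ hρ, t]
  have p201 : T[2,0,1;2,0,1] = 1 / 6 := by rw [rows_201 ρ hρ, cols_201 ρ hρ, t]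
  rcases (show i = 0 ∨ i = 1 ∨ i = 2 by fin_cases i <;> simp) with rfl | rfl | rfl <;>
    rcases (show j = 0 ∨ j = 1 ∨ j = 2 by fin_cases j <;> simp) with rfl | rfl | rfl <;>
    rcases (show k = 0 ∨ k = 1 ∨ k = 2 by fin_cases k <;> simp) with rfl | rfl | rfl <;>
    first
    | (rw [if_pos (by decide)]; first | exact t | exact p102 | exact p021 | exact p210 | exact p120 | exact p201)
    | (rw [if_neg (by decide)]; refine row_vanish ρ hρ ?_ _ _ _; decide)

end Model

end Summit.Ventures.YMGap.HaarThirdMomentSU3
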